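import Summits.CriticalPhenomena.Ising3DConformalLimit.Theorems.IsingEuclidUpgradeIsingEuclidUpgradeR2RotInvPowerLawSeqBulk
import Summits.CriticalPhenomena.Ising3DConformalLimit.Theorems.IsingEuclidUpgradeIsingEuclidUpgradeR2RotInvPowerLawTestUniqueness
import Summits.CriticalPhenomena.Ising3DConformalLimit.Theorems.IsingEuclidUpgradeIsingEuclidUpgradeR2RotInvPowerLawAxisKernel
import Summits.CriticalPhenomena.Ising3DConformalLimit.Theorems.HarmonicMomentsIsotropyTwoPointAsymptoticIsotropyOfRayRV
import HarnessLib

/-!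
# Crux `IsingEuclidUpgradeR2RotInvPowerLaw` (stmt-CriticalPhenomena-0634) — line `tower_profile_rigidity`,
# variant V, file 1: VAGUE ISOTROPY FIXES THE CLUSTER KERNELS

Write `G := criticalTwoPoint 3` (critical two-point function of the nearest-neighbour Ising model on `ℤ³`),
`g(n) := G(n e₀)`.  Two hypotheses, both OPEN statements about `G` used here only as assumptions:

* S2 at `Δ` (integer dilation law on the axis): `g(kn) k^{2Δ} / g(n) → 1` for every `k ≥ 1`;
* V = `Theses.HarmonicMomentsIsotropy.TwoPointAsymptoticIsotropy` (item stmt-CriticalPhenomena-6036): for every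
  continuous compactly supported `φ ≥ 0`, `φ ≢ 0` on `ℝ³` and every `R ∈ O(3)`,
  `Σ_x φ(Rx/L) G(x) / Σ_x φ(x/L) G(x) → 1` as `L → ∞`.

THE RESULTS.
* `kernel_rotInv_of_vague` — V ALONE makes the kernel `K(y) = S₂(0,y)` of EVERY sequential limit of the renormalised
  pair correlator (`ρ > 0` on `(0,1]`, mesh sequence `u k → 0⁺`, `S₂ > 0` off the diagonal) `O(3)`-INVARIANT:
  `K(T y) = K(y)` for every linear isometry `T` and `y ≠ 0`.  Mechanism: `T` is given by an orthogonal matrix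
  (`exists_orthogonal_of_linearIsometryEquiv`); for a test function `φ` supported in an annulus the two lattice sums
  in V at `L = 1/u_k`, multiplied by `u_k³ ρ(u_k)²`, converge to `∫ φ∘T · K` and `∫ φ · K > 0`
  (`tendsto_scaled_latticeSum_seq`, sequential Riemann sums), so V forces `∫ φ∘T · K = ∫ φ · K`; the du
  Bois-Reymond lemma off the origin (`kernel_isometry_invariant_of_integrals`) gives the pointwise identity.  No
  reflection positivity, no homogeneity, no exponent window is used.
* `kernel_eq_rpow_of_dilationLawAt_of_vague` — with S2 at `Δ` in addition and the PINNED renormalisation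
  `ρ_pin`: `S₂(0,y) = ‖y‖^{-2Δ}` (rotate `y` to the axis, use `kernel_axis_rpow_of_dilationLawAt` and the pinning
  `S₂(0,e₀) = 1`).
* `pairLimit_of_dilationLaw_of_vague` (registered name) — hence the cluster point is unique and the pinned pair
  zoom converges along the full filter `δ → 0⁺`, locally uniformly off the diagonal, to `‖z₁ − z₀‖^{-2Δ}`
  (compactness from `uniformRegularity_of_dilationLaw`, the contradiction schema of `pairLimit_of_rayRV`).

So S2 ∧ V give the two-point scaling limit; file 2 (`…VagueToRays`) turns it into the ray dilation law Sray and
the crux given T1.  References: H. Duminil-Copin, ICM 2022, §8.1, §8.4 [DuminilCopinICM2022] (rotation invariance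
and the existence of `η` on `ℤ³` are open — this file is conditional on both hypotheses); G. B. Folland, *Real
Analysis* (1999), Thm. 2.24.  No definitions are introduced.
-/

noncomputable section

namespace Summit.CriticalPhenomena.Ising3DConformalLimit.Cruxes.IsingEuclidUpgradeR2RotInvPowerLaw.TowerProfileRigidity

open Literature.Probability.LatticeModels MeasureTheory Filter Set
open scoped Topology
open Summit.CriticalPhenomena.Ising3DConformalLimit.MoebiusLimitExistsOnlyInteraction (rhoPin rhoPin_pos)
open Summit.CriticalPhenomena.Ising3DConformalLimit.HyperoctahedralRPTwoPoint
open Summit.CriticalPhenomena.Ising3DConformalLimit.HarmonicMomentsIsotropyTwoPoint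
open Summit.CriticalPhenomena.Ising3DConformalLimit.HarmonicMomentsIsotropyTwoPoint.RayRV
open Summit.CriticalPhenomena.Ising3DConformalLimit.Theses.HarmonicMomentsIsotropy
open Summit.CriticalPhenomena.Ising3DConformalLimit.Theses

/-! ### Test functions vanishing near the origin: integrability and positivity of `∫ φ K` -/

/-- A product `φ · g` with `φ` continuous and vanishing on a ball around `0` and `g` continuous off `0` is
continuous. [folklore] -/
theorem continuous_mul_kernel {φ g : EuclideanSpace ℝ (Fin 3) → ℝ} (hφ : Continuous φ)
    {ε : ℝ} (hε : 0 < ε) (hφε : ∀ y, ‖y‖ < ε → φ y = 0) (hg : ContinuousOn g {0}ᶜ) :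
    Continuous fun y => φ y * g y := by
  rw [continuous_iff_continuousAt]
  intro y
  by_cases hy : y = 0
  · -- near `0` the product vanishes identically
    have hev : (fun z => φ z * g z) =ᶠ[𝓝 y] fun _ => 0 := by
      have hball : Metric.ball (0 : EuclideanSpace ℝ (Fin 3)) ε ∈ 𝓝 y := by
        subst hy; exact Metric.ball_mem_nhds _ hε
      filter_upwards [hball] with z hz
      rw [hφε z (by simpa using hz), zero_mul]
    exact (continuousAt_const.congr (EventuallyEq.symm hev))
  · have hgy : ContinuousAt g y := hg.continuousAt (isOpen_compl_singleton.mem_nhds hy)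
    exact hφ.continuousAt.mul hgy

/-- For `φ ≥ 0` continuous, compactly supported, vanishing near `0` and positive somewhere, and `K` continuous and
positive off `0`: `∫ φ K > 0`. [folklore] -/
theorem integral_mul_kernel_pos {φ K : EuclideanSpace ℝ (Fin 3) → ℝ} (hφ : Continuous φ)
    (hφs : HasCompactSupport φ) (hφ0 : ∀ y, 0 ≤ φ y) (hφpos : ∃ y, 0 < φ y)
    {ε : ℝ} (hε : 0 < ε) (hφε : ∀ y, ‖y‖ < ε → φ y = 0)
    (hKcont : ContinuousOn K {0}ᶜ) (hKpos : ∀ y, y ≠ 0 → 0 < K y) :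
    0 < ∫ y, φ y * K y := by
  have hcont : Continuous fun y => φ y * K y := continuous_mul_kernel hφ hε hφε hKcont
  have hnonneg : 0 ≤ fun y => φ y * K y := by
    intro y
    by_cases hy : y = 0
    · have : φ y = 0 := hφε y (by rw [hy, norm_zero]; exact hε)
      simp [this]
    · exact mul_nonneg (hφ0 y) (hKpos y hy).le
  have hint : Integrable (fun y => φ y * K y) := by
    refine hcont.integrable_of_hasCompactSupport ?_
    exact hφs.mul_right
  rw [integral_pos_iff_support_of_nonneg hnonneg hint]
  obtain ⟨y₀, hy₀⟩ := hφpos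
  have hy₀ne : y₀ ≠ 0 := by
    intro h
    have : φ y₀ = 0 := hφε y₀ (by rw [h, norm_zero]; exact hε)
    linarith
  have hmem : y₀ ∈ Function.support fun y => φ y * K y := by
    rw [Function.mem_support]
    exact (mul_pos hy₀ (hKpos y₀ hy₀ne)).ne'
  exact (hcont.isOpen_support.measure_pos_iff volume).2 ⟨y₀, hmem⟩

/-! ### Vague isotropy passes to the cluster kernels -/

/-- **Vague isotropy fixes the rotations of every cluster kernel.** Under V
(`TwoPointAsymptoticIsotropy`), for every sequential limit `S₂` of the renormalised critical pair correlator
(renormalisation `ρ > 0` on `(0,1]`, mesh sequence `u k → 0⁺`, locally uniform convergence off the diagonal,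
`S₂ > 0` there), the kernel `y ↦ S₂(0,y)` is invariant under every linear isometry of `ℝ³`, off the origin.
[cite: DuminilCopinICM2022, §8.1] -/
theorem kernel_rotInv_of_vague (hV : TwoPointAsymptoticIsotropy) {ρ : ℝ → ℝ}
    (hρ : ∀ δ ∈ Set.Ioc (0:ℝ) 1, 0 < ρ δ) {u : ℕ → ℝ} (hu : Tendsto u atTop (𝓝[>] (0 : ℝ)))
    {S2 : (Fin 2 → EuclideanSpace ℝ (Fin 3)) → ℝ}
    (hconv2 : TendstoLocallyUniformlyOn (fun k => rescaledCorrelator (criticalCorr 3) ρ 2 (u k)) S2 atTop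
      (NonCoincident 3 2))
    (hpos : ∀ z ∈ NonCoincident 3 2, 0 < S2 z)
    (T : EuclideanSpace ℝ (Fin 3) ≃ₗᵢ[ℝ] EuclideanSpace ℝ (Fin 3)) :
    ∀ y : EuclideanSpace ℝ (Fin 3), y ≠ 0 → S2 ![0, T y] = S2 ![0, y] := by
  set K : EuclideanSpace ℝ (Fin 3) → ℝ := fun y => S2 ![0, y] with hK
  have hKcont : ContinuousOn K {0}ᶜ := kernel_continuousOn_seq hu hconv2
  have hKpos : ∀ y : EuclideanSpace ℝ (Fin 3), y ≠ 0 → 0 < K y := fun y hy =>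
    hpos _ (zero_pair_mem_nonCoincident hy)
  refine kernel_isometry_invariant_of_integrals hKcont T ?_
  intro φ hφc hφs hφ0 hφpos hφε
  obtain ⟨ε, hε, hφε⟩ := hφε
  -- bounds and support radius of `φ`
  obtain ⟨B, hB⟩ : ∃ B, ∀ y, |φ y| ≤ B := by
    obtain ⟨C, hC⟩ := hφc.bounded_above_of_compact_support hφs
    exact ⟨C, fun y => by rw [← Real.norm_eq_abs]; exact hC _⟩
  obtain ⟨M, hM⟩ : ∃ M : ℝ, ∀ y : EuclideanSpace ℝ (Fin 3), M < ‖y‖ → φ y = 0 := by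
    obtain ⟨C, hC⟩ := hφs.isCompact.isBounded.exists_norm_le
    refine ⟨C, fun y hy => image_eq_zero_of_notMem_tsupport fun hmem => ?_⟩
    exact absurd (hC y hmem) (not_le.2 hy)
  -- the same data for `φ ∘ T`
  have hTc : Continuous fun y => φ (T y) := hφc.comp T.continuous
  have hTB : ∀ y, |φ (T y)| ≤ B := fun y => hB _
  have hTε : ∀ y : EuclideanSpace ℝ (Fin 3), ‖y‖ < ε → φ (T y) = 0 := fun y hy =>
    hφε _ (by rwa [LinearIsometryEquiv.norm_map])
  have hTM : ∀ y : EuclideanSpace ℝ (Fin 3), M < ‖y‖ → φ (T y) = 0 := fun y hy =>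
    hM _ (by rwa [LinearIsometryEquiv.norm_map])
  -- sequential bulk convergence of the two lattice sums
  have hN := tendsto_scaled_latticeSum_seq hu hconv2 (Ψ := fun y => φ (T y)) hTB hε hTε hTM
    (Eventually.of_forall fun y => hTc.continuousAt)
  have hD := tendsto_scaled_latticeSum_seq hu hconv2 (Ψ := φ) hB hε hφε hM
    (Eventually.of_forall fun y => hφc.continuousAt)
  have hIpos : 0 < ∫ y, φ y * S2 ![0, y] :=
    integral_mul_kernel_pos hφc hφs hφ0 hφpos hε hφε hKcont hKpos
  -- V at `L_k = 1/u_k` for the orthogonal matrix of `T`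
  obtain ⟨R, hR⟩ := exists_orthogonal_of_linearIsometryEquiv T
  set ψ : (Fin 3 → ℝ) → ℝ := fun v => φ (WithLp.toLp 2 v) with hψ
  have hψc : Continuous ψ := hφc.comp (PiLp.continuous_toLp 2 _)
  have hψs : HasCompactSupport ψ :=
    hφs.comp_homeomorph (PiLp.homeomorph 2 (fun _ : Fin 3 => ℝ)).symm
  have hψ0 : ∀ v, 0 ≤ ψ v := fun v => hφ0 _
  have hψpos : ∃ v, 0 < ψ v := by
    obtain ⟨y, hy⟩ := hφpos
    exact ⟨y.ofLp, by simpa [hψ] using hy⟩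
  have hVR := hV ψ hψc hψs hψ0 hψpos R
  have hL : Tendsto (fun k => (u k)⁻¹) atTop atTop := tendsto_inv_nhdsGT_zero.comp hu
  have hratio := hVR.comp hL
  -- identify the two sums of V with those of the bulk lemma
  have hupos : ∀ᶠ k in atTop, u k ∈ Set.Ioo (0:ℝ) 1 :=
    Cruxes.ExistsScaleCovariantLimit.TwoHierarchies.ItemMaps.eventually_mem_Ioo_of_tendsto_nhdsGT' hu one_pos
  have h1 : ∀ k, ∀ x : Site 3, ψ ((u k)⁻¹⁻¹ • (R.1.mulVec fun i => (x i : ℝ))) =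
      φ (T ((u k) • siteVec x)) := by
    intro k x
    rw [inv_inv]
    have hTx : T ((u k) • siteVec x) = WithLp.toLp 2 ((u k) • (R.1.mulVec fun i => (x i : ℝ))) := by
      apply WithLp.ofLp_injective
      rw [hR, WithLp.ofLp_smul, Matrix.mulVec_smul]
      rfl
    rw [hTx]
  have h2 : ∀ k, ∀ x : Site 3, ψ ((u k)⁻¹⁻¹ • fun i => (x i : ℝ)) = φ ((u k) • siteVec x) := by
    intro k x
    rw [inv_inv]
    rfl
  have hratio' : Tendsto (fun k => (∑' x : Site 3, φ (T ((u k) • siteVec x)) * criticalTwoPoint 3 x) /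
      (∑' x : Site 3, φ ((u k) • siteVec x) * criticalTwoPoint 3 x)) atTop (𝓝 1) := by
    refine hratio.congr fun k => ?_
    simp only [Function.comp_apply, h1, h2]
  -- divide the bulk limits
  have hQ := hN.div hD hIpos.ne'
  have hQ' : Tendsto (fun k => (∑' x : Site 3, φ (T ((u k) • siteVec x)) * criticalTwoPoint 3 x) /
      (∑' x : Site 3, φ ((u k) • siteVec x) * criticalTwoPoint 3 x)) atTop
      (𝓝 ((∫ y, φ (T y) * S2 ![0, y]) / ∫ y, φ y * S2 ![0, y])) := by
    refine hQ.congr' ?_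
    filter_upwards [hupos] with k hk
    have hc : (u k) ^ 3 * ρ (u k) ^ 2 ≠ 0 := by
      have hρk : 0 < ρ (u k) := hρ _ ⟨hk.1, hk.2.le⟩
      exact mul_ne_zero (pow_ne_zero 3 hk.1.ne') (pow_ne_zero 2 hρk.ne')
    simp only [Pi.div_apply]
    rw [mul_div_mul_left _ _ hc]
  have hlim := tendsto_nhds_unique hQ' hratio'
  rw [div_eq_one_iff_eq hIpos.ne'] at hlim
  exact hlim

/-! ### With S2: the kernel is the pure power `‖·‖^{-2Δ}` -/

/-- **Under S2 at `Δ` and V, every sequential limit of the PINNED pair zoom has the kernel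
`S₂(0, y) = ‖y‖^{-2Δ}`.** A reflection maps `e₀` to `y/‖y‖` (`kernel_rotInv_of_vague`), the axis values are
`t^{-2Δ} S₂(0,e₀)` (`kernel_axis_rpow_of_dilationLawAt`), and `S₂(0, e₀) = 1` by the pinning.
[cite: DuminilCopinICM2022, §8.1] -/
theorem kernel_eq_rpow_of_dilationLawAt_of_vague {Δ : ℝ}
    (hdil : ∀ k : ℕ, 1 ≤ k → Tendsto (fun n : ℕ =>
      criticalTwoPoint 3 (Pi.single 0 ((k * n : ℕ) : ℤ)) * (k : ℝ) ^ (2 * Δ) /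
        criticalTwoPoint 3 (Pi.single 0 ((n : ℕ) : ℤ))) atTop (𝓝 1))
    (hV : TwoPointAsymptoticIsotropy) {u : ℕ → ℝ} (hu : Tendsto u atTop (𝓝[>] (0 : ℝ)))
    {S2 : (Fin 2 → EuclideanSpace ℝ (Fin 3)) → ℝ}
    (hconv2 : TendstoLocallyUniformlyOn (fun k => rescaledCorrelator (criticalCorr 3) rhoPin 2 (u k)) S2
      atTop (NonCoincident 3 2))
    (hpos : ∀ z ∈ NonCoincident 3 2, 0 < S2 z)
    {y : EuclideanSpace ℝ (Fin 3)} (hy : y ≠ 0) :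
    S2 ![0, y] = ‖y‖ ^ (-(2 * Δ)) := by
  -- pinning: `S₂(0, e₀) = 1`
  set v : EuclideanSpace ℝ (Fin 3) := EuclideanSpace.single 0 1 with hv
  have hKv : S2 ![0, v] = 1 := by
    have h1 : Tendsto (fun k => rescaledCorrelator (criticalCorr 3) rhoPin 2 (u k) ![0, v]) atTop
        (𝓝 (S2 ![0, v])) := hconv2.tendsto_at PinnedClusterPoints.cfg01_mem
    have h2 : Tendsto (fun k => rescaledCorrelator (criticalCorr 3) rhoPin 2 (u k) ![0, v]) atTop
        (𝓝 1) := by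
      simp_rw [hv, PinnedClusterPoints.rescaled_pin_cfg01]
      exact tendsto_const_nhds
    exact tendsto_nhds_unique h1 h2
  -- axis values
  set t : ℝ := ‖y‖ with ht
  have htpos : 0 < t := norm_pos_iff.2 hy
  have haxis : S2 ![0, EuclideanSpace.single 0 t] = t ^ (-(2 * Δ)) :=
    by rw [kernel_axis_rpow_of_dilationLawAt hdil rhoPin_pos hu hconv2 hpos t htpos, ← hv, hKv, mul_one]
  -- rotate `e₀` to `y/‖y‖`
  set w : EuclideanSpace ℝ (Fin 3) := t⁻¹ • y with hw
  have hvn : ‖v‖ = 1 := by simp [hv]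
  have hwn : ‖w‖ = 1 := by
    rw [hw, norm_smul, norm_inv, Real.norm_of_nonneg htpos.le, ← ht, inv_mul_cancel₀ htpos.ne']
  set T := (Submodule.span ℝ {v - w})ᗮ.reflection with hT
  have hTv : T v = w := Submodule.reflection_sub (by rw [hvn, hwn])
  have hy' : T (t • v) = y := by
    rw [map_smul, hTv, hw, smul_smul, mul_inv_cancel₀ htpos.ne', one_smul]
  have htv : t • v = EuclideanSpace.single 0 t := by
    rw [hv, AxisKernel.smul_single_zero, mul_one]
  have htv0 : t • v ≠ 0 := by
    rw [htv]; intro h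
    have := congrArg (fun z : EuclideanSpace ℝ (Fin 3) => z 0) h
    simp [htpos.ne'] at this
  rw [← hy', kernel_rotInv_of_vague hV rhoPin_pos hu hconv2 hpos T (t • v) htv0, htv, haxis]

/-! ### Uniqueness of the cluster point: the pinned pair zoom converges along the full filter -/

/-- **S2 ∧ V give the two-point scaling limit (registered name `pairLimit_of_dilationLaw_of_vague`).** Under the
integer dilation law on the axis at `Δ` and vague asymptotic isotropy,
`ρ_pin(δ)² ⟨σ_{[z₀/δ]} σ_{[z₁/δ]}⟩_{β_c} → ‖z₁ − z₀‖^{-2Δ}` locally uniformly on `{z₀ ≠ z₁}` as `δ → 0⁺`.  If not, a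
compact set, an `ε > 0` and a mesh sequence witness a defect; a subsequence converges (compactness from
`uniformRegularity_of_dilationLaw`) and its limit is the same power kernel
(`kernel_eq_rpow_of_dilationLawAt_of_vague`, translation invariance) — contradiction.
[cite: DuminilCopinICM2022, §8.4] -/
theorem pairLimit_of_dilationLaw_of_vague : ∀ {Δ : ℝ}, (∀ k : ℕ, 1 ≤ k → Filter.Tendsto (fun n : ℕ => Literature.Probability.LatticeModels.criticalTwoPoint 3 (Pi.single 0 ((k * n : ℕ) : ℤ)) * (k : ℝ) ^ (2 * Δ) / Literature.Probability.LatticeModels.criticalTwoPoint 3 (Pi.single 0 ((n : ℕ) : ℤ))) Filter.atTop (nhds 1)) → Summit.CriticalPhenomena.Ising3DConformalLimit.Theses.HarmonicMomentsIsotropy.TwoPointAsymptoticIsotropy → TendstoLocallyUniformlyOn (Literature.Probability.LatticeModels.rescaledCorrelator (Literature.Probability.LatticeModels.criticalCorr 3) Summit.CriticalPhenomena.Ising3DConformalLimit.MoebiusLimitExistsOnlyInteraction.rhoPin 2) (fun z => ‖z 1 - z 0‖ ^ (-(2 * Δ))) (nhdsWithin (0:ℝ) (Set.Ioi 0)) (Literature.Probability.LatticeModels.NonCoincident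 3 2) := by
  intro Δ hdil hV
  have hUR := uniformRegularity_of_dilationLaw ⟨Δ, hdil⟩
  rw [tendstoLocallyUniformlyOn_iff_forall_isCompact (isOpen_nonCoincident 3 2)]
  intro K hKsub hK
  rw [Metric.tendstoUniformlyOn_iff]
  intro ε hε
  by_contra hnot
  have hfreq : ∃ᶠ δ in 𝓝[>] (0:ℝ), ∃ x ∈ K,
      ε ≤ dist (‖x 1 - x 0‖ ^ (-(2 * Δ))) (rescaledCorrelator (criticalCorr 3) rhoPin 2 δ x) := by
    rw [Filter.not_eventually] at hnot
    refine hnot.mono fun δ hδ => ?_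
    push Not at hδ
    exact hδ
  obtain ⟨u, hu, hux⟩ := exists_seq_forall_of_frequently hfreq
  choose xs hxsK hxs using hux
  obtain ⟨φ, S, hφ, -, hconv, hSpos⟩ := exists_seqLimit_of_uniformRegularity hUR hu
  have huφ : Tendsto (u ∘ φ) atTop (𝓝[>] (0:ℝ)) := hu.comp hφ.tendsto_atTop
  have hconv2 : TendstoLocallyUniformlyOn
      (fun k => rescaledCorrelator (criticalCorr 3) rhoPin 2 ((u ∘ φ) k)) (S 2) atTop
      (NonCoincident 3 2) := hconv 2
  -- the limit along the subsequence is the power kernel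
  have hS2 : ∀ z ∈ NonCoincident 3 2, S 2 z = ‖z 1 - z 0‖ ^ (-(2 * Δ)) := by
    intro z hz
    have hinj : Function.Injective z := hz
    have hne : z 0 ≠ z 1 := fun h => absurd (hinj h) (by decide)
    have hz' : z = ![z 0, z 1] := by
      funext i; fin_cases i <;> rfl
    rw [hz', limit_two_eq_of_sub_seq huφ hconv2 hne,
      kernel_eq_rpow_of_dilationLawAt_of_vague hdil hV huφ hconv2 hSpos (sub_ne_zero.2 hne.symm)]
    simp
  -- uniform convergence on `K` along the subsequence contradicts the defect
  have hunif := (tendstoLocallyUniformlyOn_iff_forall_isCompact (isOpen_nonCoincident 3 2)).1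
    hconv2 K hKsub hK
  rw [Metric.tendstoUniformlyOn_iff] at hunif
  obtain ⟨k, hk⟩ := (hunif ε hε).exists
  have h1 := hk (xs (φ k)) (hxsK (φ k))
  rw [hS2 _ (hKsub (hxsK (φ k)))] at h1
  exact absurd h1 (not_lt.2 (hxs (φ k)))

end Summit.CriticalPhenomena.Ising3DConformalLimit.Cruxes.IsingEuclidUpgradeR2RotInvPowerLaw.TowerProfileRigidity

end
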